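import Literature.Geometry.Riemannian.ConjugateHeatEntropyJensen
import Literature.Geometry.Riemannian.KernelNashEntropy
import Mathlib.Analysis.SpecialFunctions.Log.NegMulLog
import HarnessLib

/-!
# The functional inequality behind Bamler's no-local-collapsing theorem
# (Bamler 2020a, §6, proof of Thm. 6.1)

R. Bamler, *Entropy and heat kernel bounds on a Ricci flow background*, arXiv:2008.07093 (2020a),
§6, proof of Thm. 6.1: let `(M, (g_t))` be a Ricci flow on a closed manifold `Mᵐ`, `s < t`, and
let `ψ > 0` be a smooth probability density for `dg_t`. Let `v` be the backward conjugate heat flow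
on `M × [s, t]` with `v(t) = ψ` and put `τ₀ := t + (t − s)`, `𝒩(r) := 𝒩[g_r, f_r, τ₀ − r]`,
`𝒲(r) := 𝒲[g_r, f_r, τ₀ − r]`, `v(r) = (4π(τ₀ − r))^{-m/2} e^{-f_r}`. Then

* `2(t − s) 𝒩(s) − (t − s) 𝒩(t) = ∫_s^t 𝒲 ≤ (t − s) 𝒲(t)` (Prop. 5.2: `d/dτ(τ𝒩) = 𝒲`, `𝒲`
  non-decreasing in `r`), i.e. `2𝒩(s) ≤ 𝒩(t) + 𝒲(t)`;
* `𝒩(s) ≥ ∫ ψ(x) 𝒩*_s(x, t) dg_t(x) − (m/2) log 2` (Jensen,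
  `integral_mul_pointedNashEntropy_le_neg_integral_mul_log`);
* `𝒩(t) = −∫ ψ log ψ − (m/2) log(4π(t − s)) − m/2` and
  `𝒲(t) = (t − s) ∫ (|∇ψ|²/ψ + Rψ) − ∫ ψ log ψ − (m/2) log(4π(t − s)) − m`.

Combining,

  `2 ∫ ψ 𝒩*_s(·, t) dg_t ≤ (t − s) ∫ |∇ψ|²/ψ dg_t + (t − s) ∫ R ψ dg_t − 2 ∫ ψ log ψ dg_t`
  `− m log(4π(t − s)) − 3m/2 + m log 2`,

which is the core inequality of the proof of Thm. 6.1 (applied there to a cut-off `ψ` of a ball).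

* `integral_neg_log_sub_mul` — `∫ (−log ψ − c) ψ = −∫ ψ log ψ − c` for a probability density;
* `gradSq_neg_log_sub_mul` — `|∇(−log u − c)|² u = |∇u|²/u`;
* `pointedNashEntropy_eq_of_integral_eq_one` — `𝒩(r) = −∫ u log u − (n/2) log(4π(τ₀ − r)) − n/2`;
* `wEntropy_neg_log_sub_eq` — `𝒲[g, −log ψ − c, τ]` in terms of `ψ`;
* `IsRicciFlow.two_mul_pointedNashEntropy_le` — `2𝒩(0) ≤ 𝒩(T') + 𝒲(T')` (basepoint `2T'`) along a
  positive unit-mass conjugate heat flow on `[0, T']`;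
* `two_mul_integral_mul_pointedNashEntropy_le` — **the inequality above**.

Everything is proved; no definitions, no named facts.

## References

* R. H. Bamler, *Entropy and heat kernel bounds on a Ricci flow background*, arXiv:2008.07093
  (2020), §5.1, Prop. 5.2; §6, proof of Thm. 6.1. [Bamler2020Entropy]
* G. Perelman, *The entropy formula for the Ricci flow and its geometric applications*,
  arXiv:math/0211159 (2002), §3.1, (3.4). [Perelman2002]
-/

noncomputable section

open Set Filter Function MeasureTheory Measure Module
open scoped Manifold ContDiff Topology ENNReal NNReal

namespace Literature.Geometry.Riemannian

open Lorentzian Lorentzian.PseudoRiemannianMetric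

/-! ### Measure-theoretic bookkeeping -/

section Density

variable {α : Type*} [MeasurableSpace α] {μ : Measure α}

/-- `∫ (−log ψ − c) ψ dμ = −∫ ψ log ψ dμ − c` for an integrable `ψ` of unit mass with `ψ log ψ`
integrable. [folklore] -/
theorem integral_neg_log_sub_mul {ψ : α → ℝ} (hψi : Integrable ψ μ)
    (hψl : Integrable (fun x ↦ ψ x * Real.log (ψ x)) μ) (hψ1 : ∫ x, ψ x ∂μ = 1) (c : ℝ) :
    ∫ x, (-Real.log (ψ x) - c) * ψ x ∂μ = -∫ x, ψ x * Real.log (ψ x) ∂μ - c := by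
  have e : (fun x ↦ (-Real.log (ψ x) - c) * ψ x) =
      fun x ↦ -(ψ x * Real.log (ψ x)) - c * ψ x := by
    funext x
    ring
  have hneg : Integrable (fun x ↦ -(ψ x * Real.log (ψ x))) μ := hψl.neg
  have hcm : Integrable (fun x ↦ c * ψ x) μ := hψi.const_mul c
  rw [e, integral_sub hneg hcm, integral_neg, integral_const_mul, hψ1, mul_one]

end Density

/-! ### Static identities: `|∇f|² u = |∇u|²/u`, `𝒩` and `𝒲` of `f = −log ψ − c` -/

section Static

variable {m : ℕ} {H : Type*} [TopologicalSpace H]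
  {I : ModelWithCorners ℝ (EuclideanSpace ℝ (Fin m)) H} [I.Boundaryless]
  {M : Type*} [TopologicalSpace M] [ChartedSpace H M] [IsManifold I ∞ M]
  [T2Space M] [CompactSpace M] [MeasurableSpace M] [BorelSpace M]

omit [I.Boundaryless] [T2Space M] [CompactSpace M] [MeasurableSpace M] [BorelSpace M] in
/-- **`|∇(−log u − c)|² u = |∇u|²/u`** at a point where the positive function `u` is
differentiable (chain rule `d(−log u) = −du/u`). [folklore] -/
theorem gradSq_neg_log_sub_mul
    (g : PseudoRiemannianMetric I ∞ (EuclideanSpace ℝ (Fin m)) (TangentSpace I : M → Type _))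
    {u : M → ℝ} {p : M} (hu : MDifferentiableAt I 𝓘(ℝ, ℝ) u p) (hpos : ∀ x, 0 < u x) (c : ℝ) :
    g.gradSq (fun y ↦ -Real.log (u y) - c) p * u p = g.gradSq u p / u p := by
  have hF : HasDerivAt (fun s : ℝ ↦ -Real.log s - c) (-(u p)⁻¹) (u p) := by
    simpa using ((Real.hasDerivAt_log (hpos p).ne').neg).sub_const c
  have hcomp : (fun y ↦ -Real.log (u y) - c) = (fun s : ℝ ↦ -Real.log s - c) ∘ u := rfl
  rw [hcomp, PseudoRiemannianMetric.gradSq_real_comp g hF hu]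
  field_simp [(hpos p).ne']

omit [I.Boundaryless] in
/-- **The pointed Nash entropy of a unit-mass density**:
`𝒩(r) = −∫ u(r) log u(r) dV_{g(r)} − (n/2) log(4π(τ₀ − r)) − n/2` when `u(r)` is continuous with
`∫ u(r) dV_{g(r)} = 1` (`f(r) = −log u(r) − (n/2) log(4π(τ₀ − r))`).
[cite: Bamler2020Entropy, §5.1, Def. 5.1] -/
theorem pointedNashEntropy_eq_of_integral_eq_one
    (g : ℝ → PseudoRiemannianMetric I ∞ (EuclideanSpace ℝ (Fin m)) (TangentSpace I : M → Type _))
    {u : ℝ → M → ℝ} (n : ℕ) (τ₀ : ℝ) {r : ℝ} (huc : Continuous (u r))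
    (hmass : ∫ x, u r x ∂(g r).riemVolume = 1) :
    pointedNashEntropy g u n τ₀ r =
      -∫ x, u r x * Real.log (u r x) ∂(g r).riemVolume -
        (n : ℝ) / 2 * Real.log (4 * Real.pi * (τ₀ - r)) - (n : ℝ) / 2 := by
  rw [pointedNashEntropy_def]
  simp only [entropyPotential_apply]
  rw [integral_neg_log_sub_mul ((g r).integrable_of_continuous huc)
    ((g r).integrable_of_continuous (Real.continuous_mul_log.comp huc)) hmass]

/-- **`𝒲` of the potential of a positive probability density** (Bamler 2020a, §5.1, the display
defining `𝒲[g, f, τ]`, evaluated at `f = −log ψ − c` with `(4πτ)^{-m/2} e^{-f} = ψ`): on a closed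
manifold modelled on `ℝᵐ`, for `ψ > 0` smooth with `∫ ψ dV = 1` and continuous scalar curvature,
`𝒲[g, f, τ] = τ ∫ |∇ψ|²/ψ dV + τ ∫ R ψ dV − ∫ ψ log ψ dV − c − m`
(`|∇f|² ψ = |∇ψ|²/ψ`). [cite: Bamler2020Entropy, §5.1, first display] -/
theorem wEntropy_neg_log_sub_eq
    (g : PseudoRiemannianMetric I ∞ (EuclideanSpace ℝ (Fin m)) (TangentSpace I : M → Type _))
    (cov : CovariantDerivative I (EuclideanSpace ℝ (Fin m)) (TangentSpace I : M → Type _))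
    (hRc : Continuous fun x ↦ g.scalarCurvatureWith cov x) {ψ : M → ℝ}
    (hψ : ContMDiff I 𝓘(ℝ, ℝ) ∞ ψ) (hψ0 : ∀ x, 0 < ψ x) (hψ1 : ∫ x, ψ x ∂g.riemVolume = 1)
    {c τ : ℝ} (hdens : entropyDensity m (fun x ↦ -Real.log (ψ x) - c) τ = ψ) :
    g.wEntropy cov (fun x ↦ -Real.log (ψ x) - c) τ =
      τ * ∫ x, g.gradSq ψ x / ψ x ∂g.riemVolume +
        τ * ∫ x, g.scalarCurvatureWith cov x * ψ x ∂g.riemVolume -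
        ∫ x, ψ x * Real.log (ψ x) ∂g.riemVolume - c - (m : ℝ) := by
  have hψc : Continuous ψ := hψ.continuous
  have hψ1' : ContMDiff I 𝓘(ℝ, ℝ) 1 ψ := hψ.of_le (by norm_cast)
  have hG : Continuous fun x ↦ g.gradSq ψ x := continuous_innerDual_mvfderiv g hψ1' hψ1'
  have hgf : ∀ x, g.gradSq (fun y ↦ -Real.log (ψ y) - c) x * ψ x = g.gradSq ψ x / ψ x := fun x ↦
    gradSq_neg_log_sub_mul g ((hψ x).mdifferentiableAt (by simp)) hψ0 c
  -- integrability of the four pieces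
  have hi1 : Integrable (fun x ↦ g.gradSq ψ x / ψ x) g.riemVolume :=
    g.integrable_of_continuous (hG.div hψc fun x ↦ (hψ0 x).ne')
  have hi2 : Integrable (fun x ↦ g.scalarCurvatureWith cov x * ψ x) g.riemVolume :=
    g.integrable_of_continuous (hRc.mul hψc)
  have hi3 : Integrable (fun x ↦ (-Real.log (ψ x) - c) * ψ x) g.riemVolume := by
    refine g.integrable_of_continuous ?_
    have e : (fun x ↦ (-Real.log (ψ x) - c) * ψ x) =
        fun x ↦ -(ψ x * Real.log (ψ x)) - c * ψ x := by
      funext x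
      ring
    rw [e]
    exact (Real.continuous_mul_log.comp hψc).neg.sub (continuous_const.mul hψc)
  have hi4 : Integrable ψ g.riemVolume := g.integrable_of_continuous hψc
  have hψl : Integrable (fun x ↦ ψ x * Real.log (ψ x)) g.riemVolume :=
    g.integrable_of_continuous (Real.continuous_mul_log.comp hψc)
  rw [PseudoRiemannianMetric.wEntropy_def, finrank_euclideanSpace_fin, hdens]
  have hpt : (fun x ↦
      (τ * (g.scalarCurvatureWith cov x + g.gradSq (fun y ↦ -Real.log (ψ y) - c) x) +
        (-Real.log (ψ x) - c) - (m : ℝ)) * ψ x) =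
      fun x ↦ τ * (g.gradSq ψ x / ψ x) + τ * (g.scalarCurvatureWith cov x * ψ x) +
        (-Real.log (ψ x) - c) * ψ x - (m : ℝ) * ψ x := by
    funext x
    rw [← hgf x]
    ring
  have hA : Integrable (fun x ↦ τ * (g.gradSq ψ x / ψ x)) g.riemVolume := hi1.const_mul τ
  have hB : Integrable (fun x ↦ τ * (g.scalarCurvatureWith cov x * ψ x)) g.riemVolume :=
    hi2.const_mul τ
  have hAB : Integrable (fun x ↦ τ * (g.gradSq ψ x / ψ x) + τ * (g.scalarCurvatureWith cov x * ψ x))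
      g.riemVolume := hA.add hB
  have hABC : Integrable (fun x ↦ τ * (g.gradSq ψ x / ψ x) +
      τ * (g.scalarCurvatureWith cov x * ψ x) + (-Real.log (ψ x) - c) * ψ x) g.riemVolume :=
    hAB.add hi3
  have hD : Integrable (fun x ↦ (m : ℝ) * ψ x) g.riemVolume := hi4.const_mul _
  rw [hpt, integral_sub hABC hD, integral_add hAB hi3, integral_add hA hB, integral_const_mul,
    integral_const_mul, integral_const_mul, hψ1, mul_one, integral_neg_log_sub_mul hi4 hψl hψ1 c]
  ring

end Static

/-! ### `2𝒩(0) ≤ 𝒩(T') + 𝒲(T')` along a conjugate heat flow on `[0, T']` -/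

section Flow

variable {m : ℕ} {H : Type*} [TopologicalSpace H]
  {I : ModelWithCorners ℝ (EuclideanSpace ℝ (Fin m)) H} [I.Boundaryless]
  {M : Type*} [TopologicalSpace M] [ChartedSpace H M] [IsManifold I ∞ M]
  [T2Space M] [CompactSpace M] [MeasurableSpace M] [BorelSpace M]
  {g : ℝ → PseudoRiemannianMetric I ∞ (EuclideanSpace ℝ (Fin m)) (TangentSpace I : M → Type _)}
  {cov : ℝ → CovariantDerivative I (EuclideanSpace ℝ (Fin m)) (TangentSpace I : M → Type _)}

/-- **`2𝒩(0) ≤ 𝒩(T') + 𝒲(T')` with basepoint time `2T'`** (Bamler 2020a, proof of Thm. 6.1,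
from Prop. 5.2): for a Ricci flow of Riemannian metrics on `[0, T']`, `T' > 0`, on a closed
manifold and a positive unit-mass conjugate heat solution `u`,
`2T' 𝒩(0) − T' 𝒩(T') = ∫_0^{T'} 𝒲 ≤ T' 𝒲(T')`
(`IsRicciFlow.mul_pointedNashEntropy_sub_le_mul_wEntropy`).
[cite: Bamler2020Entropy, §6, proof of Thm. 6.1] -/
theorem IsRicciFlow.two_mul_pointedNashEntropy_le {T' : ℝ} (hT' : 0 < T')
    (h : IsRicciFlow g cov (Icc 0 T')) (hR : ∀ t ∈ Icc 0 T', (g t).IsRiemannian)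
    {u : ℝ → M → ℝ} (hpos : ∀ t ∈ Icc 0 T', ∀ x, 0 < u t x)
    (hsol : IsConjugateHeatSolutionOn g cov (Icc 0 T') u)
    (hmass : ∀ t ∈ Icc 0 T', ∫ x, u t x ∂(g t).riemVolume = 1) :
    2 * pointedNashEntropy g u m (2 * T') 0 ≤
      pointedNashEntropy g u m (2 * T') T' +
        (g T').wEntropy (cov T') (entropyPotential u m (2 * T') T') T' := by
  have key := h.mul_pointedNashEntropy_sub_le_mul_wEntropy hT' hR hpos hsol hmass
    (τ₀ := 2 * T') (by linarith) (t₁ := 0) (t₂ := T') ⟨le_rfl, hT'.le⟩ ⟨hT'.le, le_rfl⟩ hT'.le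
  rw [show 2 * T' - T' = T' by ring, sub_zero, sub_zero] at key
  have h2 : T' * (2 * pointedNashEntropy g u m (2 * T') 0) ≤
      T' * (pointedNashEntropy g u m (2 * T') T' +
        (g T').wEntropy (cov T') (entropyPotential u m (2 * T') T') T') := by
    linarith
  exact le_of_mul_le_mul_left h2 hT'

end Flow

/-! ### The inequality of the proof of Thm. 6.1 -/

section NLC

variable {m : ℕ} {H : Type*} [TopologicalSpace H]
  {I : ModelWithCorners ℝ (EuclideanSpace ℝ (Fin m)) H} [I.Boundaryless]
  {M : Type*} [TopologicalSpace M] [ChartedSpace H M] [IsManifold I ∞ M]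
  [T2Space M] [CompactSpace M] [SecondCountableTopology M] [MeasurableSpace M] [BorelSpace M]
  [ConnectedSpace M]
  {h : ℝ → PseudoRiemannianMetric I ∞ (EuclideanSpace ℝ (Fin m)) (TangentSpace I : M → Type _)}
  {cov : ℝ → CovariantDerivative I (EuclideanSpace ℝ (Fin m)) (TangentSpace I : M → Type _)}
  {a T : ℝ} (hflow : IsRicciFlow h cov (Icc a T)) (hh : IsContMDiffFamilyOn ∞ h univ)
  (hR : ∀ r, (h r).IsRiemannian)

/-- **The functional inequality behind the no-local-collapsing theorem** (Bamler 2020a, §6,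
proof of Thm. 6.1): for a Ricci flow on a closed connected manifold `Mᵐ`, `a < s < t ≤ T`, and a
smooth positive probability density `ψ` for `dg_t`,
`2 ∫ ψ 𝒩*_s(·, t) dg_t ≤ (t − s) ∫ |∇ψ|²/ψ dg_t + (t − s) ∫ R ψ dg_t − 2 ∫ ψ log ψ dg_t`
`− m log(4π(t − s)) − 3m/2 + m log 2`.
Proof: with the backward conjugate heat flow `v` of `ψ` on `[s, t]` and basepoint time `2t − s`,
`2𝒩(s) ≤ 𝒩(t) + 𝒲(t)` (`IsRicciFlow.two_mul_pointedNashEntropy_le`, time-translated),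
`𝒩(s) ≥ ∫ ψ 𝒩*_s(·,t) dg_t − (m/2) log 2` (Jensen,
`integral_mul_pointedNashEntropy_le_neg_integral_mul_log`), and the static expressions of
`𝒩(t)`, `𝒲(t)` through `ψ` (`pointedNashEntropy_eq_of_integral_eq_one`, `wEntropy_neg_log_sub_eq`).
[cite: Bamler2020Entropy, §6, proof of Thm. 6.1] -/
theorem two_mul_integral_mul_pointedNashEntropy_le {s t : ℝ} (has : a < s) (hst : s < t)
    (htT : t ≤ T) {ψ : M → ℝ} (hψ : ContMDiff I 𝓘(ℝ, ℝ) ∞ ψ) (hψ0 : ∀ x, 0 < ψ x)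
    (hψ1 : ∫ x, ψ x ∂(h t).riemVolume = 1) :
    2 * ∫ x, ψ x * pointedNashEntropy h (fun r w ↦ hflow.heatKernelFn hh hR t x (w, r)) m t s
        ∂(h t).riemVolume ≤
      (t - s) * ∫ x, (h t).gradSq ψ x / ψ x ∂(h t).riemVolume +
        (t - s) * ∫ x, (h t).scalarCurvatureWith (cov t) x * ψ x ∂(h t).riemVolume -
        2 * ∫ x, ψ x * Real.log (ψ x) ∂(h t).riemVolume -
        (m : ℝ) * Real.log (4 * Real.pi * (t - s)) - 3 * (m : ℝ) / 2 + (m : ℝ) * Real.log 2 := by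
  have hT' : 0 < t - s := sub_pos.2 hst
  have ht : t ∈ Icc a T := ⟨(has.trans hst).le, htT⟩
  have hts : t - s + s = t := sub_add_cancel t s
  -- the translated flow on `[0, t - s]` and the backward conjugate heat flow of `ψ`
  have hflow' : IsRicciFlow (fun r ↦ h (r + s)) (fun r ↦ cov (r + s)) (Icc 0 (t - s)) := by
    refine (hflow.comp_add_const s).mono fun r hr ↦ ?_
    exact ⟨by linarith [hr.1], by linarith [hr.2]⟩
  have hR' : ∀ r ∈ Icc (0 : ℝ) (t - s), (h (r + s)).IsRiemannian := fun r _ ↦ hR _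
  obtain ⟨u, huT, hu⟩ := hflow'.exists_isConjugateHeatSolutionOn_Icc hT' hR' ψ hψ
  have hupos : ∀ r ∈ Icc (0 : ℝ) (t - s), ∀ y, 0 < u r y :=
    hflow'.pos_of_isConjugateHeatSolutionOn hT' hR' hu fun y ↦ by rw [huT]; exact hψ0 y
  have humass : ∀ r ∈ Icc (0 : ℝ) (t - s), ∫ y, u r y ∂(h (r + s)).riemVolume = 1 := by
    intro r hr
    have h1 : ∫ y, u (t - s) y ∂(h (t - s + s)).riemVolume = 1 := by rw [huT, hts]; exact hψ1
    exact IsRicciFlow.integral_eq_one_of_isConjugateHeatSolutionOn hT' hflow' hR' hu h1 hr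
  -- the same solution on `[s, t]` for the original flow, and the Jensen step
  have hv : IsConjugateHeatSolutionOn h cov (Icc s t) fun r ↦ u (r - s) := by
    have key := hu.comp_sub_const (h := h) (cov := cov) hT'
    rw [zero_add, hts] at key
    exact key
  have hvt : (fun r ↦ u (r - s)) t = ψ := huT
  have hJ := integral_mul_pointedNashEntropy_le_neg_integral_mul_log hflow hh hR has hst htT hψ
    hψ0 hψ1 hv hvt
  simp only [sub_self] at hJ
  -- `2𝒩(0) ≤ 𝒩(t - s) + 𝒲(t - s)` for the translated flow
  have hineq := hflow'.two_mul_pointedNashEntropy_le hT' hR' hupos hu humass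
  -- the three terms
  have hu0c : Continuous (u 0) :=
    (contMDiff_slice_of_contMDiffOn hu.1 ⟨le_rfl, hT'.le⟩).continuous
  have hN0 := pointedNashEntropy_eq_of_integral_eq_one (fun r ↦ h (r + s)) (u := u) m (2 * (t - s))
    hu0c (humass 0 ⟨le_rfl, hT'.le⟩)
  have hN1 := pointedNashEntropy_eq_of_integral_eq_one (fun r ↦ h (r + s)) (u := u) m (2 * (t - s))
    (r := t - s) (by rw [huT]; exact hψ.continuous) (humass (t - s) ⟨hT'.le, le_rfl⟩)
  have hpot : entropyPotential u m (2 * (t - s)) (t - s) =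
      fun x ↦ -Real.log (ψ x) - (m : ℝ) / 2 * Real.log (4 * Real.pi * (t - s)) := by
    funext x
    rw [entropyPotential_apply, huT, show 2 * (t - s) - (t - s) = t - s by ring]
  have hRc : Continuous fun x ↦ (h t).scalarCurvatureWith (cov t) x :=
    (contMDiff_scalarCurvatureWith_holds I M (h t) (cov t) (hflow.isLeviCivita t ht)).continuous
  have hW := wEntropy_neg_log_sub_eq (h t) (cov t) hRc hψ hψ0 hψ1
    (entropyDensity_neg_log m hψ0 hT')
  simp only [zero_add, sub_zero] at hN0
  rw [huT, hts, show 2 * (t - s) - (t - s) = t - s by ring] at hN1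
  simp only [hts, hpot] at hineq
  rw [hN0, hN1, hW] at hineq
  -- `log(8π(t − s)) = log 2 + log(4π(t − s))`
  have hlog : Real.log (4 * Real.pi * (2 * (t - s))) =
      Real.log 2 + Real.log (4 * Real.pi * (t - s)) := by
    rw [show 4 * Real.pi * (2 * (t - s)) = 2 * (4 * Real.pi * (t - s)) by ring,
      Real.log_mul two_ne_zero (by positivity)]
  rw [hlog] at hineq
  linarith

end NLC

end Literature.Geometry.Riemannian

end
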